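import Mathlib

/-!
# Lexicographic products of ladders — explicit, elementary proof (support file)

Item `stmt-MatrixMultiplication-14308` (`FourierTwoFamiliesModP.PrimeTwoFamilies`, Cohn–Kleinberg–Szegedy–Umans
2005, Conj. 4.7 with prime cyclic hosts), line `Sketch`, registered stub `isLadder_lexProd`
(siege k2, variation "explicit / elementary route"; an independent proof of the same statement is in
namespace `…Theorems.PrimeTwoFamilies.LadderLift`, this file keeps its own namespace).

A LADDER in an abelian group `G` is an ordered family of classes `(X c, Y c)`, `c : Fin r`, with

* (`hW`, directness) inside one class, `(x - x') + (y - y') = 0` with `x, x' ∈ X c`, `y, y' ∈ Y c`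
  forces `x = x'` and `y = y'`;
* (`hL`, one-directional separation) for classes `p < q`, every cross difference `y' - x'`
  (`x' ∈ X p`, `y' ∈ Y q`) differs from every diagonal difference `y - x` (`x ∈ X c`, `y ∈ Y c`).

`isLadder_lexProd`: the family on `Fin (r₁ * r₂)` with classes
`X₁ c.divNat ×ˢ X₂ c.modNat`, `Y₁ c.divNat ×ˢ Y₂ c.modNat ⊆ G₁ × G₂` built from a ladder in `G₁` and a
ladder in `G₂` is again a ladder.

Proof, kept deliberately explicit and elementary:

1. `divNat_lt_or_modNat_lt` — the mixed-radix digits `c = c.divNat * r₂ + c.modNat` compare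
   lexicographically: from `p < q`, monotonicity of `· / r₂` gives `p / r₂ ≤ q / r₂`; if the quotients
   are equal, cancelling the common term `r₂ * (q / r₂)` in `r₂ * (p / r₂) + p % r₂ < r₂ * (q / r₂) + q % r₂`
   leaves `p % r₂ < q % r₂`.  Only `Nat.div_le_div_right`, `Nat.div_add_mod` and additive cancellation
   are used (no decision procedure).
2. Elements of `G₁ × G₂` are destructured into explicit pairs; `Prod.mk_sub_mk`, `Prod.mk_add_mk`,
   `Prod.mk_eq_zero` and injectivity of `Prod.mk` turn each vector identity into its two coordinate
   identities, to which the hypotheses of the two factor ladders apply verbatim: directness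
   coordinatewise, separation in the first coordinate when `p.divNat < q.divNat` and in the second
   when `p.modNat < q.modNat`.

Mathlib only; no route declaration is imported (the stub is stated over Mathlib primitives).
-/

-- single-conjunct summit: the mandated namespace repeats `MatrixMultiplication` (summit = sub-problem).
set_option linter.dupNamespace false

namespace Summit.MatrixMultiplication.MatrixMultiplication.Theorems.PrimeTwoFamilies.LadderLexProdK2

/-- **Mixed-radix digits compare lexicographically.**  For `p < q` in `Fin (r₁ * r₂)`, either the
leading digits already satisfy `p.divNat < q.divNat`, or the trailing digits satisfy
`p.modNat < q.modNat` (the latter happens exactly when the leading digits agree).  Elementary proof: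
`p / r₂ ≤ q / r₂` by monotonicity of division, and in the case of equality the remainders compare by
cancelling `r₂ * (q / r₂)` from `p = r₂ * (p / r₂) + p % r₂ < r₂ * (q / r₂) + q % r₂ = q`. -/
theorem divNat_lt_or_modNat_lt {r₁ r₂ : ℕ} {p q : Fin (r₁ * r₂)} (hpq : p < q) :
    p.divNat < q.divNat ∨ p.modNat < q.modNat := by
  have hpq' : (p : ℕ) < (q : ℕ) := Fin.lt_def.1 hpq
  -- monotonicity of `· / r₂`
  have hdiv : (p : ℕ) / r₂ ≤ (q : ℕ) / r₂ := Nat.div_le_div_right hpq'.le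
  rcases Nat.lt_or_eq_of_le hdiv with hlt | heq
  · -- the leading digits already compare strictly
    left
    rw [Fin.lt_def, Fin.coe_divNat, Fin.coe_divNat]
    exact hlt
  · -- equal leading digits: cancel them and compare the trailing digits
    right
    rw [Fin.lt_def, Fin.coe_modNat, Fin.coe_modNat]
    have hp : r₂ * ((p : ℕ) / r₂) + (p : ℕ) % r₂ = (p : ℕ) := Nat.div_add_mod (p : ℕ) r₂
    have hq : r₂ * ((q : ℕ) / r₂) + (q : ℕ) % r₂ = (q : ℕ) := Nat.div_add_mod (q : ℕ) r₂
    have hsum : r₂ * ((q : ℕ) / r₂) + (p : ℕ) % r₂ < r₂ * ((q : ℕ) / r₂) + (q : ℕ) % r₂ :=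
      calc r₂ * ((q : ℕ) / r₂) + (p : ℕ) % r₂
          = r₂ * ((p : ℕ) / r₂) + (p : ℕ) % r₂ := by rw [heq]
        _ = (p : ℕ) := hp
        _ < (q : ℕ) := hpq'
        _ = r₂ * ((q : ℕ) / r₂) + (q : ℕ) % r₂ := hq.symm
    exact Nat.lt_of_add_lt_add_left hsum

/-- **Lexicographic products of ladders are ladders** (registered stub `isLadder_lexProd`, explicit
elementary proof).  Given a ladder `(X₁ c, Y₁ c)_{c < r₁}` in `G₁` (directness `hW₁`, one-directional
separation `hL₁`) and a ladder `(X₂ c, Y₂ c)_{c < r₂}` in `G₂` (`hW₂`, `hL₂`), the family indexed by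
`c : Fin (r₁ * r₂)` with classes `X₁ c.divNat ×ˢ X₂ c.modNat` and `Y₁ c.divNat ×ˢ Y₂ c.modNat` in
`G₁ × G₂` is a ladder: every class is direct (first conjunct, coordinatewise) and the family is
one-directionally separated (second conjunct: `p < q` gives `p.divNat < q.divNat`, separated by `hL₁` in
the first coordinate, or `p.modNat < q.modNat`, separated by `hL₂` in the second). -/
theorem isLadder_lexProd {G₁ G₂ : Type*} [AddCommGroup G₁] [AddCommGroup G₂] {r₁ r₂ : ℕ}
    (X₁ Y₁ : Fin r₁ → Finset G₁) (X₂ Y₂ : Fin r₂ → Finset G₂)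
    (hW₁ : ∀ c : Fin r₁, ∀ x ∈ X₁ c, ∀ x' ∈ X₁ c, ∀ y ∈ Y₁ c, ∀ y' ∈ Y₁ c,
      (x - x') + (y - y') = 0 → x = x' ∧ y = y')
    (hL₁ : ∀ c p q : Fin r₁, p < q → ∀ x ∈ X₁ c, ∀ y ∈ Y₁ c, ∀ x' ∈ X₁ p, ∀ y' ∈ Y₁ q,
      y - x ≠ y' - x')
    (hW₂ : ∀ c : Fin r₂, ∀ x ∈ X₂ c, ∀ x' ∈ X₂ c, ∀ y ∈ Y₂ c, ∀ y' ∈ Y₂ c,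
      (x - x') + (y - y') = 0 → x = x' ∧ y = y')
    (hL₂ : ∀ c p q : Fin r₂, p < q → ∀ x ∈ X₂ c, ∀ y ∈ Y₂ c, ∀ x' ∈ X₂ p, ∀ y' ∈ Y₂ q,
      y - x ≠ y' - x') :
    (∀ c : Fin (r₁ * r₂), ∀ x ∈ X₁ c.divNat ×ˢ X₂ c.modNat, ∀ x' ∈ X₁ c.divNat ×ˢ X₂ c.modNat,
        ∀ y ∈ Y₁ c.divNat ×ˢ Y₂ c.modNat, ∀ y' ∈ Y₁ c.divNat ×ˢ Y₂ c.modNat,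
        (x - x') + (y - y') = 0 → x = x' ∧ y = y') ∧
    (∀ c p q : Fin (r₁ * r₂), p < q →
        ∀ x ∈ X₁ c.divNat ×ˢ X₂ c.modNat, ∀ y ∈ Y₁ c.divNat ×ˢ Y₂ c.modNat,
        ∀ x' ∈ X₁ p.divNat ×ˢ X₂ p.modNat, ∀ y' ∈ Y₁ q.divNat ×ˢ Y₂ q.modNat, y - x ≠ y' - x') := by
  constructor
  · -- directness of the class `c`: both coordinates of the vector identity vanish.
    rintro c ⟨a₁, a₂⟩ ha ⟨a₁', a₂'⟩ ha' ⟨b₁, b₂⟩ hb ⟨b₁', b₂'⟩ hb' h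
    simp only [Finset.mem_product] at ha ha' hb hb'
    -- `((a₁,a₂) - (a₁',a₂')) + ((b₁,b₂) - (b₁',b₂')) = ((a₁-a₁') + (b₁-b₁'), (a₂-a₂') + (b₂-b₂'))`
    rw [Prod.mk_sub_mk, Prod.mk_sub_mk, Prod.mk_add_mk, Prod.mk_eq_zero] at h
    -- first coordinate: directness of class `c.divNat` of the first ladder
    have h₁ : a₁ = a₁' ∧ b₁ = b₁' := hW₁ c.divNat a₁ ha.1 a₁' ha'.1 b₁ hb.1 b₁' hb'.1 h.1
    -- second coordinate: directness of class `c.modNat` of the second ladder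
    have h₂ : a₂ = a₂' ∧ b₂ = b₂' := hW₂ c.modNat a₂ ha.2 a₂' ha'.2 b₂ hb.2 b₂' hb'.2 h.2
    rw [h₁.1, h₁.2, h₂.1, h₂.2]
    exact ⟨rfl, rfl⟩
  · -- one-directional separation for `p < q`.
    rintro c p q hpq ⟨a₁, a₂⟩ ha ⟨b₁, b₂⟩ hb ⟨a₁', a₂'⟩ ha' ⟨b₁', b₂'⟩ hb' h
    simp only [Finset.mem_product] at ha hb ha' hb'
    -- `(b₁,b₂) - (a₁,a₂) = (b₁',b₂') - (a₁',a₂')` splits into its two coordinates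
    rw [Prod.mk_sub_mk, Prod.mk_sub_mk, Prod.mk.injEq] at h
    rcases divNat_lt_or_modNat_lt hpq with hlt | hlt
    · -- leading digits `p.divNat < q.divNat`: the first ladder separates the first coordinates
      exact hL₁ c.divNat p.divNat q.divNat hlt a₁ ha.1 b₁ hb.1 a₁' ha'.1 b₁' hb'.1 h.1
    · -- trailing digits `p.modNat < q.modNat`: the second ladder separates the second coordinates
      exact hL₂ c.modNat p.modNat q.modNat hlt a₂ ha.2 b₂ hb.2 a₂' ha'.2 b₂' hb'.2 h.2

end Summit.MatrixMultiplication.MatrixMultiplication.Theorems.PrimeTwoFamilies.LadderLexProdK2
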